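import Literature.Probability.LatticeModels.ImprovedTreeDiagramBoundProofs
import Literature.Probability.LatticeModels.SlidingScaleInfraredBoundProofs
import HarnessLib

/-!
# Aizenman–Duminil-Copin 2021, Lemma 6.3 (growth of the bubble diagram in `d = 4`): discharge

Topic `Literature/Probability/LatticeModels`. The named fact
`aizenmanDuminilCopin_bubbleDiagram_growth` (`ImprovedTreeDiagramBound.lean`; M. Aizenman,
H. Duminil-Copin, *Marginal triviality of the scaling limits of critical 4D Ising and `φ⁴₄` models*,
Ann. of Math. **194** (2021), arXiv:1912.07973, **Lemma 6.3**, in the form its proof establishes: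
`B_L(β) ≤ (1 + C (1 + log(L/ℓ))/log ℓ) B_ℓ(β)` for integer scales `2 ≤ ℓ ≤ L ≤ ξ(β)`,
`0 ≤ β ≤ β_c`, every `μ ∈ 𝒢(β,0)`) was reduced in the tree to ADC Theorem 5.6 (the sliding-scale
infrared bound, `aizenmanDuminilCopin_slidingScaleInfraredBound`) by
`aizenmanDuminilCopin_bubbleDiagram_growth_of_slidingScaleInfraredBound`
(`ImprovedTreeDiagramBoundProofs.lean`), and Theorem 5.6 is now a theorem of the tree
(`aizenmanDuminilCopin_slidingScaleInfraredBound_holds`, `SlidingScaleInfraredBoundProofs.lean`).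
This file records the resulting discharge `aizenmanDuminilCopin_bubbleDiagram_growth_holds`
(no new definition, no new named fact).

## References

* M. Aizenman, H. Duminil-Copin, Ann. of Math. 194 (2021), arXiv:1912.07973, Lemma 6.3 and its proof,
  Theorem 5.6 [AizenmanDuminilCopinAnnals2021].
-/

namespace Literature.Probability.LatticeModels

/-- **Aizenman–Duminil-Copin 2021, Lemma 6.3 (growth of the bubble diagram, `d = 4`), discharged**:
the named fact `aizenmanDuminilCopin_bubbleDiagram_growth` holds — by the tree's reduction to the
sliding-scale infrared bound (ADC Thm 5.6, `aizenmanDuminilCopin_bubbleDiagram_growth_of_slidingScaleInfraredBound`)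
and the tree's proof of the latter (`aizenmanDuminilCopin_slidingScaleInfraredBound_holds`).
[cite: AizenmanDuminilCopinAnnals2021, arXiv:1912.07973 Lemma 6.3 (with Theorem 5.6)] -/
theorem aizenmanDuminilCopin_bubbleDiagram_growth_holds : aizenmanDuminilCopin_bubbleDiagram_growth :=
  aizenmanDuminilCopin_bubbleDiagram_growth_of_slidingScaleInfraredBound
    aizenmanDuminilCopin_slidingScaleInfraredBound_holds

end Literature.Probability.LatticeModels
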